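import Summits.CriticalPhenomena.Ising3D.Control2DL13TwoSided095
import Summits.CriticalPhenomena.Ising3D.Control2DL15BoxP
import Mathlib.Tactic.NormNum
import HarnessLib

/-!
# The class-1 window in the kernel down to `0.30`: `0.95 < Δ_ε < 1.0006` at `Δ_σ = 1/8` under `A2D′` (window `Δ_ε ≥ 0.30`)
(cell `pub-ising3x`, seat controls-1 gen 18; KERNEL PATH for the 2D γ-certificates, Λ ≤ 15 class-1 cover — CONTROL-ONLY)

HONEST FRAMING: lottery ticket; floor = tightest certified 3D Ising CFT bounds; no exact-solution
claim without a proof. CONTROL-ONLY (`d = 2`, `Δ_σ = 1/8`, axiom set `A2D′`); nothing about `d = 3`; weaker than the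
reader-certified statement of record (`0.99 < Δ_ε < 1.00005`, Λ = 19, readers A ∧ B).

The first Λ = 15 certificate in the kernel — the RB-4 / E₀ = 40 kind-`box` certificate P `[3/10, 37/100]`
(`j129649`, 20 spins, truncation `N ≥ 40`, `Nd = 63` at spin 0; kernel-complete: `Control2DL15BoxP`) — prepended to
the Λ ≤ 13 cover `excludedOn_2d_L13_cover095`:
* `excludedOn_2d_L15_cover030 : ExcludedOn (1/8) 2 1 (Icc (3/10) (19/20))`;
* `twoSided_2d_L15_kernel030 : TwoSided (1/8) 2 1 (3/10) (19/20) (5003/5000)` — under `A2D′` at `Δ_σ = 1/8` an `ε`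
  location `x ≥ 0.30` lies in `(0.95, 1.0006)` (2D Ising: `Δ_ε = 1`), resting on the Lean kernel alone.
No facts, standard axioms only.
-/

namespace Summit.CriticalPhenomena.Ising3D.Control2D

open Set
open Literature.MathematicalPhysics.QuantumFieldTheory.ConformalBootstrap3D

/-- **Kernel-complete cover of the `ε` locations `[3/10, 19/20]`** at `Δ_σ = 1/8` under `A2D′` (RB-4 Λ = 15 box P,
RB-2 Λ = 11 boxes B–J, Λ = 13 boxes K–N, E₀ = 40 box O). CONTROL-ONLY (d = 2). [cite: RattazziEtAl2008, §5.5] -/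
theorem excludedOn_2d_L15_cover030 : ExcludedOn (1 / 8 : ℝ) 2 1 (Icc (3 / 10 : ℝ) (19 / 20)) :=
  excludedOn_Icc_append excludedOn_2d_L15_boxP excludedOn_2d_L13_cover095 le_rfl

/-- **2D control, class 1, kernel-complete, Λ ≤ 15 (E₀ ≤ 40)**: under `A2D′` at `Δ_σ = 1/8` an `ε` location
`x ≥ 3/10` satisfies `19/20 < x < 5003/5000`. CONTROL-ONLY (d = 2). [cite: RattazziEtAl2008, §5.5] -/
theorem twoSided_2d_L15_kernel030 : TwoSided (1 / 8 : ℝ) 2 1 (3 / 10) (19 / 20) (5003 / 5000) :=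
  twoSided_of_cover excludedOn_2d_L15_cover030 gapExcluded_2d_L11_gapA (by norm_num)

end Summit.CriticalPhenomena.Ising3D.Control2D
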